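import Summits.QuantumAdvantage.AdviceFreeQNC0.FibreDecimation37NHFibre
import HarnessLib

/-!
# Cell qa-qnc0, `p = 3` — ROUND-37P2 typed targets at `m = 1` are FALSE: explicit counterexamples to `Exp37.FibreNonExact37NH` and
# `Exp37.FibreNonExact37` (W-R85-7 / P2-38h: "land the m = 1 refutation next to it")

Planner qa-qnc0-p2 g37's typed statements (`FibreDecimation37.lean`) quantify over every odd `m`, including `m = 1`, where the decimation
method has no content (`B_{k₀} ≠ 0`, Lemma 37.D(ii) needs a second support coin) — and where the STATEMENTS fail.  The witness, for an odd
number `N` of outside coins (`z = N + 1`, chosen coin `c₀ = 0`, pattern `a = (1)`, all residues `0`):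

  test `k₀`: direction `(1,1,…,1)`;   blind tests `k_c` (`c ∈ Y`): direction `1_Y + e_c` (zero at `c₀`, letter `2` at `c`, `1` elsewhere on `Y`).

On the even coset `H_0` the number of firing tests is ALWAYS EVEN (`testParity_cex`: with `n = |u|_Y|`, it is
`[|u| ≢ 0] + n[n+1 ≢ 0] + (N−n)[n ≢ 0] (mod 3 inside, mod 2 outside)`, even in both cases `u_{c₀} = 0, n` even / `u_{c₀} = 1, n` odd), so the
test parity agrees with the constant target `0` on ALL of `H_0`; the decimated set is `{k₀}` (blind tests never enter it), of `Y`-weight `N`, so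
(NH) holds as soon as `2(3/4)^N ≤ 1/50` (`N = 17`) and (Gen_d) with `d = N` as soon as `(5/3)(2^{−N} + (√3/2)^N) ≤ 1/20` (`N = 27`).

* `testParity_cex`, `decimSet_cex`, `weightY_cex`, `nhCond_cex`, `genD_cex`;
* **`not_fibreNonExact37NH : ¬ FibreNonExact37NH`**, **`not_fibreNonExact37 : ¬ FibreNonExact37`**.

The positive statements for `m ≥ 3` are `fibreNonExact37NH_of_three_le` (`FibreDecimation37NH.lean`) and `fibreNonExact37_of_three_le`
(`FibreDecimation37GenD.lean`).  The cell's counterexample (qn-prover-3 g24); not in print.  WHAT THIS IS NOT: no statement about the game.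
-/

noncomputable section

namespace Summit.QuantumAdvantage.AdviceFreeQNC0.Exp37

open Finset
open Summit.QuantumAdvantage.AdviceFreeQNC0 F4
open Literature.Computability.MetaComplexity Literature.Computability.MetaComplexity.ModTestProduct

namespace CexM1

/-! ### The witness -/

/-- The chosen coin: `c₀ = 0`. -/
def ιc (N : ℕ) : Fin 1 ↪ Fin (N + 1) := ⟨fun _ => 0, fun a b _ => Subsingleton.elim a b⟩

/-- The pattern on the chosen coin: letter `1`. -/
def ac : Fin 1 → Bool := fun _ => false

/-- The directions: test `0` is all-ones; test `k ≠ 0` is `1_Y + e_k` (zero at `c₀`, `2` at coin `k`, `1` elsewhere). -/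
def βc (N : ℕ) (k c : Fin (N + 1)) : ZMod 3 :=
  if k = 0 then 1 else if c = 0 then 0 else if c = k then 2 else 1

/-- All residues are `0`. -/
def rc (N : ℕ) (_k : Fin (N + 1)) : ZMod 3 := 0

variable {N : ℕ}

/-- `(n : ℤ/3) = 0 ↔ 3 ∣ n` (private copy of the tree's `Coset21.natCast_zmod3_eq_zero_iff`, to keep the imports small). -/
private theorem natCast_eq_zero_iff (n : ℕ) : (n : ZMod 3) = 0 ↔ n % 3 = 0 := by
  rw [← ZMod.val_eq_zero, ZMod.val_natCast]

/-- The outside weight `n(u) = #{i : u(i+1)}`. -/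
def nOut (u : Fin (N + 1) → Bool) : ℕ := (univ.filter fun i : Fin N => u i.succ = true).card

/-- `|u| = [u 0] + n(u)`. -/
theorem card_true_eq (u : Fin (N + 1) → Bool) :
    (univ.filter fun c => u c = true).card = (if u 0 then 1 else 0) + nOut u := by
  unfold nOut
  rw [card_filter, card_filter, Fin.sum_univ_succ]

/-- The linear form of test `0`: `⟨β_0, u⟩ = |u|`. -/
theorem form_zero (u : Fin (N + 1) → Bool) :
    (∑ c, if u c then βc N 0 c else 0) = (((if u 0 then 1 else 0) + nOut u : ℕ) : ZMod 3) := by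
  rw [← card_true_eq, ← Finset.sum_boole]
  refine sum_congr rfl fun c _ => ?_
  unfold βc; simp

/-- The linear form of test `i+1`: `⟨β_{i+1}, u⟩ = n(u) + [u(i+1)]`. -/
theorem form_succ (u : Fin (N + 1) → Bool) (i : Fin N) :
    (∑ c, if u c then βc N i.succ c else 0) = ((nOut u + (if u i.succ then 1 else 0) : ℕ) : ZMod 3) := by
  rw [Fin.sum_univ_succ]
  have h0 : (if u 0 then βc N i.succ 0 else 0) = 0 := by
    unfold βc; simp [Fin.succ_ne_zero]
  rw [h0, zero_add]
  have hterm : ∀ j : Fin N, (if u j.succ then βc N i.succ j.succ else 0) =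
      (if u j.succ then (1 : ZMod 3) else 0) + (if u j.succ ∧ j = i then (1 : ZMod 3) else 0) := by
    intro j
    unfold βc
    simp only [Fin.succ_ne_zero, if_false, Fin.succ_inj]
    by_cases hu : u j.succ = true
    · simp only [hu, if_true, true_and]
      by_cases hji : j = i
      · rw [if_pos hji, if_pos hji]; decide
      · rw [if_neg hji, if_neg hji, add_zero]
    · simp [hu]
  rw [sum_congr rfl fun j _ => hterm j, sum_add_distrib, Finset.sum_boole, Finset.sum_boole]
  unfold nOut
  have hcard : (univ.filter fun j : Fin N => u j.succ = true ∧ j = i).card = if u i.succ then 1 else 0 := by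
    by_cases hu : u i.succ = true
    · rw [if_pos hu]
      have e : (univ.filter fun j : Fin N => u j.succ = true ∧ j = i) = {i} := by
        ext j; simp only [mem_filter, mem_univ, true_and, mem_singleton]
        constructor
        · exact fun h => h.2
        · rintro rfl; exact ⟨hu, rfl⟩
      rw [e, card_singleton]
    · rw [if_neg hu]
      rw [card_eq_zero, filter_eq_empty_iff]
      rintro j - ⟨hj, rfl⟩
      exact hu hj
  rw [hcard]
  push_cast
  rfl

/-- Test `0` fires iff `|u| ≢ 0 (mod 3)`. -/
theorem test_zero_iff (u : Fin (N + 1) → Bool) :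
    test (βc N) (rc N) 0 u = true ↔ ((if u 0 then 1 else 0) + nOut u) % 3 ≠ 0 := by
  unfold test rc
  rw [decide_eq_true_iff, form_zero, ne_eq, natCast_eq_zero_iff]

/-- Test `i+1` fires iff `n(u) + [u(i+1)] ≢ 0 (mod 3)`. -/
theorem test_succ_iff (u : Fin (N + 1) → Bool) (i : Fin N) :
    test (βc N) (rc N) i.succ u = true ↔ (nOut u + (if u i.succ then 1 else 0)) % 3 ≠ 0 := by
  unfold test rc
  rw [decide_eq_true_iff, form_succ, ne_eq, natCast_eq_zero_iff]

/-- **The number of firing tests on the even coset is even.** -/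
theorem testParity_cex (hN : Odd N) (u : Fin (N + 1) → Bool) (hu : (univ.filter fun c => u c = true).card % 2 = 0) :
    testParity (βc N) (rc N) u = 0 := by
  unfold testParity
  rw [card_filter, Fin.sum_univ_succ]
  -- test `0`
  have h0 : (if test (βc N) (rc N) 0 u = true then 1 else 0 : ℕ) =
      if ((if u 0 then 1 else 0) + nOut u) % 3 ≠ 0 then 1 else 0 := by
    by_cases hc : ((if u 0 then 1 else 0) + nOut u) % 3 ≠ 0
    · rw [if_pos ((test_zero_iff u).2 hc), if_pos hc]
    · rw [if_neg (fun h => hc ((test_zero_iff u).1 h)), if_neg hc]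
  -- the coin tests
  have hs : ∀ i : Fin N, (if test (βc N) (rc N) i.succ u = true then 1 else 0 : ℕ) =
      if u i.succ = true then (if (nOut u + 1) % 3 ≠ 0 then 1 else 0) else (if nOut u % 3 ≠ 0 then 1 else 0) := by
    intro i
    by_cases hui : u i.succ = true
    · rw [if_pos hui]
      have h := test_succ_iff u i
      rw [if_pos hui] at h
      by_cases hc : (nOut u + 1) % 3 ≠ 0
      · rw [if_pos (h.2 hc), if_pos hc]
      · rw [if_neg (fun h' => hc (h.1 h')), if_neg hc]
    · rw [if_neg hui]
      have h := test_succ_iff u i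
      rw [if_neg hui, add_zero] at h
      by_cases hc : nOut u % 3 ≠ 0
      · rw [if_pos (h.2 hc), if_pos hc]
      · rw [if_neg (fun h' => hc (h.1 h')), if_neg hc]
  rw [h0, sum_congr rfl fun i _ => hs i, Finset.sum_ite, sum_const, sum_const, smul_eq_mul, smul_eq_mul]
  have hcompl : (univ.filter fun i : Fin N => ¬ u i.succ = true).card = N - nOut u := by
    unfold nOut
    have h := card_filter_add_card_filter_not (s := (univ : Finset (Fin N))) (fun i => u i.succ = true)
    rw [card_univ, Fintype.card_fin] at h
    omega
  rw [hcompl]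
  rw [card_true_eq] at hu
  unfold nOut at hu ⊢
  have hnN : (univ.filter fun i : Fin N => u i.succ = true).card ≤ N :=
    (card_le_univ _).trans (by rw [Fintype.card_fin])
  obtain ⟨q, hq⟩ := hN
  by_cases hu0 : u 0 = true
  · simp only [hu0, if_true] at hu ⊢
    split_ifs <;> omega
  · simp only [hu0, if_false, Bool.false_eq_true, zero_add] at hu ⊢
    split_ifs <;> omega

/-! ### The decimated set and the weights -/

/-- The restriction of a test to the chosen coin. -/
theorem restrictM_cex (k : Fin (N + 1)) : restrictM (ιc N) (βc N) k = fun _ => if k = 0 then 1 else 0 := by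
  funext i
  unfold restrictM ιc βc
  simp

/-- **The decimated set is `{k₀}`**: blind tests never enter it. -/
theorem decimSet_cex : decimSet (ιc N) ac (βc N) = {0} := by
  ext k
  rw [mem_decimSet_iff, restrictM_cex, mem_singleton]
  constructor
  · intro h
    by_contra hk
    apply h.1
    funext i; rw [if_neg hk]; rfl
  · rintro rfl
    refine ⟨fun h => ?_, Or.inl fun i _ => ?_⟩
    · have := congrFun h 0
      simp at this
    · show (if (0 : Fin (N + 1)) = 0 then (1 : ZMod 3) else 0) = lettZ false
      rw [if_pos rfl]; decide

/-- The combined form of a pattern supported on `{k₀}` is `j₀·(1,…,1)`. -/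
theorem combo_cex (j : Fin (N + 1) → ZMod 3) (hj : ∀ k, k ≠ 0 → j k = 0) (c : Fin (N + 1)) :
    (∑ k, j k * βc N k c) = j 0 := by
  rw [Finset.sum_eq_single 0]
  · unfold βc; simp
  · intro k _ hk; rw [hj k hk, zero_mul]
  · intro h; exact absurd (mem_univ _) h

/-- **The `Y`-weight of a non-zero pattern supported on `{k₀}` is `N`.** -/
theorem weightY_cex (j : Fin (N + 1) → ZMod 3) (hj0 : j ≠ 0) (hj : ∀ k, k ≠ 0 → j k = 0) :
    weightY (ιc N) (βc N) j = N := by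
  classical
  have hj00 : j 0 ≠ 0 := by
    intro h; apply hj0; funext k
    by_cases hk : k = 0
    · rw [hk, h]; rfl
    · exact hj k hk
  unfold weightY
  have e : (univ.filter fun c : Fin (N + 1) => c ∉ Set.range (ιc N) ∧ (∑ k, j k * βc N k c) ≠ 0) =
      univ.filter fun c : Fin (N + 1) => c ≠ 0 := by
    refine filter_congr fun c _ => ?_
    rw [combo_cex j hj c]
    constructor
    · rintro ⟨hc, -⟩ h0; exact hc ⟨0, h0.symm⟩
    · intro hc
      refine ⟨?_, hj00⟩
      rintro ⟨i, hi⟩; exact hc hi.symm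
  rw [e, filter_ne' univ (0 : Fin (N + 1)), card_erase_of_mem (mem_univ _), card_univ, Fintype.card_fin]
  omega

/-- The set of non-zero patterns supported on `{k₀}` has at most two elements. -/
theorem card_patterns_le (P : Finset (Fin (N + 1) → ZMod 3))
    (hP : ∀ j ∈ P, j ≠ 0 ∧ ∀ k, k ≠ 0 → j k = 0) : P.card ≤ 2 := by
  classical
  have hsub : P ⊆ ({Pi.single 0 1, Pi.single 0 2} : Finset (Fin (N + 1) → ZMod 3)) := by
    intro j hjP
    obtain ⟨hj0, hj⟩ := hP j hjP
    have hshape : j = Pi.single 0 (j 0) := by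
      funext k
      by_cases hk : k = 0
      · rw [hk, Pi.single_eq_same]
      · rw [Pi.single_eq_of_ne hk, hj k hk]
    have hj00 : j 0 ≠ 0 := by
      intro h; apply hj0; rw [hshape, h, Pi.single_zero]
    rw [mem_insert, mem_singleton]
    rcases zmod3_cases (j 0) with h | h | h
    · exact absurd h hj00
    · left; rw [hshape, h]
    · right; rw [hshape, h]
  exact (card_le_card hsub).trans (card_insert_le _ _ |>.trans (by rw [card_singleton]))

/-- **(NH) holds for the witness** once `2(3/4)^N ≤ 1/50` and `N ≥ 6`. -/
theorem nhCond_cex (h6 : 6 ≤ N) (hnum : 2 * ((3 : ℝ) / 4) ^ N ≤ 1 / 50) : NHCond (ιc N) ac (βc N) := by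
  classical
  unfold NHCond
  rw [decimSet_cex, card_singleton]
  refine ⟨by omega, ?_⟩
  set P := (univ : Finset (Fin (N + 1) → ZMod 3)).filter
    (fun j => j ≠ 0 ∧ ∀ k, k ∉ ({0} : Finset (Fin (N + 1))) → j k = 0) with hPdef
  have hP : ∀ j ∈ P, j ≠ 0 ∧ ∀ k, k ≠ 0 → j k = 0 := by
    intro j hj
    obtain ⟨-, hj0, hjk⟩ := mem_filter.1 hj
    exact ⟨hj0, fun k hk => hjk k (by rwa [mem_singleton])⟩
  calc ∑ j ∈ P, ((3 : ℝ) / 4) ^ weightY (ιc N) (βc N) j = ∑ j ∈ P, ((3 : ℝ) / 4) ^ N :=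
        sum_congr rfl fun j hj => by rw [weightY_cex j (hP j hj).1 (hP j hj).2]
    _ = P.card * ((3 : ℝ) / 4) ^ N := by rw [sum_const, nsmul_eq_mul]
    _ ≤ 2 * ((3 : ℝ) / 4) ^ N := by
        have := card_patterns_le P hP
        exact mul_le_mul_of_nonneg_right (by exact_mod_cast this) (by positivity)
    _ ≤ 1 / 50 := hnum

/-- **(Gen_d) with `d = N` holds for the witness** once `(5/3)(2^{−N} + (√3/2)^N) ≤ 1/20`. -/
theorem genD_cex (hnum : (5 : ℝ) / 3 * ((2 : ℝ)⁻¹ ^ N + (Real.sqrt 3 / 2) ^ N) ≤ 1 / 20) :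
    GenD (ιc N) ac (βc N) N := by
  classical
  unfold GenD
  rw [decimSet_cex, card_singleton, pow_one]
  refine ⟨fun j hj0 hj => ?_, ?_⟩
  · rw [weightY_cex j hj0 fun k hk => hj k (by rwa [mem_singleton])]
  · rw [show N + 1 - 1 = N from rfl]
    exact hnum

/-- The typed hypothesis on `k₀`'s letters holds. -/
theorem pattern_cex : ∀ i : Fin 1, βc N 0 (ιc N i) = lettZ (ac i) := by
  intro i; unfold βc ac; simp only [if_true]; decide

/-- **On the even coset EVERY point agrees with the constant target `0`.** -/
theorem card_agree_cex (hN : Odd N) :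
    (((coset (N + 1) 0).filter fun u => testParity (βc N) (rc N) u % 2 = affTarget 0 ∅ u % 2).card : ℝ) =
      (2 : ℝ) ^ (N + 1 - 1) := by
  have hall : ((coset (N + 1) 0).filter fun u => testParity (βc N) (rc N) u % 2 = affTarget 0 ∅ u % 2) =
      coset (N + 1) 0 := by
    refine filter_true_of_mem fun u hu => ?_
    unfold coset at hu
    rw [mem_filter] at hu
    rw [testParity_cex hN u (by simpa using hu.2)]
    unfold affTarget; simp
  rw [hall]
  have h := card_parityClass (ι := Fin (N + 1)) (by rw [Fintype.card_fin]; omega) 0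
  rw [Fintype.card_fin] at h
  exact h

end CexM1

open CexM1

/-- **The typed `FibreNonExact37NH` (ROUND-37P2 Theorem 37.F′ as typed, all odd `m`) is FALSE**: at `m = 1`, `z = 18` the test
parity of the witness agrees with the constant target on the whole coset although (NH) holds. -/
theorem not_fibreNonExact37NH : ¬ FibreNonExact37NH := by
  intro h
  have hnum : 2 * ((3 : ℝ) / 4) ^ 17 ≤ 1 / 50 := by norm_num
  have hmain := h 18 18 1 (ιc 17) (βc 17) (rc 17) 0 ac ⟨0, rfl⟩ (by norm_num) pattern_cex
    (nhCond_cex (by norm_num) hnum) 0 0 ∅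
  have hodd : Odd 17 := ⟨8, by norm_num⟩
  rw [card_agree_cex (N := 17) hodd] at hmain
  norm_num at hmain

/-- **The typed `FibreNonExact37` (Theorem 37.F as typed, all odd `m`) is FALSE**: the same witness at `z = 28`, where (Gen_d) holds with `d = 27`. -/
theorem not_fibreNonExact37 : ¬ FibreNonExact37 := by
  intro h
  have hsqrt : Real.sqrt 3 / 2 ≤ 1 := by
    rw [div_le_one (by norm_num : (0 : ℝ) < 2)]
    have h4 : Real.sqrt 3 ≤ Real.sqrt 4 := Real.sqrt_le_sqrt (by norm_num)
    have h2 : Real.sqrt 4 = 2 := by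
      rw [show (4 : ℝ) = 2 ^ 2 by norm_num, Real.sqrt_sq (by norm_num : (0 : ℝ) ≤ 2)]
    linarith
  have hsq : (Real.sqrt 3 / 2) ^ 2 = 3 / 4 := by
    rw [div_pow, Real.sq_sqrt (by norm_num : (0 : ℝ) ≤ 3)]; norm_num
  have hpow : (Real.sqrt 3 / 2) ^ 27 ≤ ((3 : ℝ) / 4) ^ 13 := by
    rw [show (27 : ℕ) = 2 * 13 + 1 by norm_num, pow_add, pow_mul, hsq, pow_one]
    exact mul_le_of_le_one_right (by positivity) hsqrt
  have hnum : (5 : ℝ) / 3 * ((2 : ℝ)⁻¹ ^ 27 + (Real.sqrt 3 / 2) ^ 27) ≤ 1 / 20 := by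
    have : (5 : ℝ) / 3 * ((2 : ℝ)⁻¹ ^ 27 + ((3 : ℝ) / 4) ^ 13) ≤ 1 / 20 := by norm_num
    nlinarith [hpow]
  have hmain := h 28 28 1 27 (ιc 27) (βc 27) (rc 27) 0 ac ⟨0, rfl⟩ (by norm_num) pattern_cex (genD_cex hnum) 0 0
  have hcount := card_agree_cex (N := 27) ⟨13, by norm_num⟩
  have e : ((coset 28 0).filter fun u => testParity (βc 27) (rc 27) u = 0 % 2) =
      (coset 28 0).filter fun u => testParity (βc 27) (rc 27) u % 2 = affTarget 0 ∅ u % 2 := by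
    refine filter_congr fun u _ => ?_
    unfold affTarget testParity
    simp
  rw [e, hcount] at hmain
  norm_num at hmain

end Summit.QuantumAdvantage.AdviceFreeQNC0.Exp37

end
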